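import Summits.ResolutionOfSingularities.ResolutionOfSingularities.Theorems.FrobeniusLadderFInjectiveMacaulayficationDiagonalCIPair
import Mathlib.LinearAlgebra.Matrix.Nondegenerate
import HarnessLib

/-!
# DIAGONAL COMPLETE-INTERSECTION TRIPLES `(Σ c₀ᵢxᵢ^{aᵢ}, Σ c₁ᵢxᵢ^{aᵢ}, Σ c₂ᵢxᵢ^{aᵢ})`: Khovanskii non-degeneracy, `x̄ᵥ ≠ 0`, regularity off the vertex — the `r = 3` twin of
# ✓ `DiagonalCIPair` (crux `FInjectiveMacaulayfication` stmt-ResolutionOfSingularities-15315, chain w45a; res-L1-w45a-plan-1 RULING R23.22 (β) «a second equal-support bed of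
# different codimension»; seat res-L1-w45a-stub-2 g13)

[OURS · L1 W4.5a] Support file (`--supports stmt-ResolutionOfSingularities-15315 --as helper`); def-free; UNCONDITIONAL; no named fact, no sorry; NOT a statement of any
manuscript; replaces the role of NO printed item. Nothing of the crux is proved. AI-written (AI review weaker than expert review).

For three coefficient rows `c₀, c₁, c₂` (all entries non-zero) and exponents `aᵢ ≥ 1` non-zero in `K`:
* §1 `eval_faceSum_pair` — the face sum over a two-vertex face evaluates to `cᵢqᵢ^{aᵢ} + cⱼqⱼ^{aⱼ}`; `det_three_rows` — the `3 × 3` coefficient minor.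
* §2 ★ `ciNondegenerate_triple` — KHOVANSKII NON-DEGENERACY ALONG EVERY POSITIVE WEIGHT, assuming the `2 × 2` minors of `(c₀, c₁)` and the `3 × 3` minors of `(c₀, c₁, c₂)` on
  distinct columns are non-zero: the common face `Φ` has one vertex (no torus zero), two vertices (the `2 × 2` minor forbids a torus zero), or at least three vertices
  `i, j, l`, where the coordinates `i, j, l` of a vanishing combination `Σ g_l ∇in F_l = 0` form the invertible `3 × 3` system.
* §3 `mk_X_ne_zero_triple` (`aᵢ ≥ 2`); §4 `mk_X_mem_of_forall_ne₃`, `mem_of_two_off`, `det_triple`, ★ `isRegularLocalRing_off_vertex_triple` — at a prime `Q ⊉ (x̄)` three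
  variables survive and the `3 × 3` Jacobian minor `aᵢaⱼa_l·det·xᵢ^{aᵢ−1}xⱼ^{aⱼ−1}x_l^{a_l−1} ∉ Q` feeds ✓ `CIJacobian.ci_clause_of_det_not_mem` (`r = 3`).
[cite: CuetoPopescupampuStepanov2023, Def. 4.2 (p. 12)] [cite: Matsumura1987, Thm. 30.4 (ii)]
-/

-- single-problem summit: the doubled namespace component is forced
set_option linter.dupNamespace false

noncomputable section

open MvPolynomial

namespace Summit.ResolutionOfSingularities.ResolutionOfSingularities.Theorems.FInjectiveMacaulayfication.DiagonalCITriple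

open Summit.ResolutionOfSingularities.ResolutionOfSingularities.Theorems.FInjectiveMacaulayfication DiagonalCIPair
open Literature.AlgebraicGeometry.Resolution Literature.AlgebraicGeometry.Resolution.BoubakriGreuelMarkwig CINondegenerate

variable {K : Type} [Field K] {n : ℕ}

/-! ## §1 Face sums over two vertices; the `3 × 3` coefficient determinant -/

/-- Evaluation of the face sum of `Σ cᵢxᵢ^{aᵢ}` over the two-vertex face `{aᵢeᵢ, aⱼeⱼ}`. [plumbing] -/
theorem eval_faceSum_pair (a : Fin n → ℕ) (ha : ∀ i, a i ≠ 0) (c : Fin n → K) (Φ : Finset (Fin n →₀ ℕ)) (i j : Fin n)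
    (hij : Finsupp.single i (a i) ≠ Finsupp.single j (a j)) (hΦ : Φ = {Finsupp.single i (a i), Finsupp.single j (a j)}) (q : Fin n → K) :
    MvPolynomial.eval q (∑ α ∈ Φ, monomial α (coeff α (∑ m : Fin n, monomial (Finsupp.single m (a m)) (c m)))) = c i * q i ^ a i + c j * q j ^ a j := by
  classical
  rw [hΦ, Finset.sum_pair hij, map_add, coeff_diag_single a ha c i, coeff_diag_single a ha c j, eval_monomial, eval_monomial,
    Finsupp.prod_single_index (by simp), Finsupp.prod_single_index (by simp)]

/-- The `3 × 3` determinant of the rows `(c₀, c₁, c₂)` on the columns `(i, j, l)`, expanded. [plumbing] -/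
theorem det_three_rows (c₀ c₁ c₂ : Fin n → K) (i j l : Fin n) :
    (Matrix.of ![![c₀ i, c₁ i, c₂ i], ![c₀ j, c₁ j, c₂ j], ![c₀ l, c₁ l, c₂ l]] : Matrix (Fin 3) (Fin 3) K).det =
      c₀ i * (c₁ j * c₂ l - c₁ l * c₂ j) - c₁ i * (c₀ j * c₂ l - c₀ l * c₂ j) + c₂ i * (c₀ j * c₁ l - c₀ l * c₁ j) := by
  rw [Matrix.det_fin_three]
  simp only [Matrix.of_apply, Matrix.cons_val_zero, Matrix.cons_val_one, Matrix.cons_val]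
  ring

/-! ## §2 ★ Khovanskii non-degeneracy of a diagonal triple -/

/-- ★ **A DIAGONAL TRIPLE IS KHOVANSKII NON-DEGENERATE ALONG EVERY POSITIVE WEIGHT** when the exponents `aᵢ`, the `2 × 2` minors of `(c₀, c₁)` and the `3 × 3` minors of `(c₀, c₁, c₂)`
on distinct columns are non-zero in `K`. See the module docstring, §2. [OURS · elementary certificate; cite: CuetoPopescupampuStepanov2023, Def. 4.2 (p. 12)] -/
theorem ciNondegenerate_triple (hn : 0 < n) (a : Fin n → ℕ) (ha : ∀ i, a i ≠ 0) (haK : ∀ i, ((a i : ℕ) : K) ≠ 0)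
    (c₀ c₁ c₂ : Fin n → K) (hc₀ : ∀ i, c₀ i ≠ 0) (hc₁ : ∀ i, c₁ i ≠ 0) (hc₂ : ∀ i, c₂ i ≠ 0)
    (hminor2 : ∀ i j, i ≠ j → c₀ i * c₁ j ≠ c₀ j * c₁ i)
    (hminor3 : ∀ i j l, i ≠ j → j ≠ l → i ≠ l →
      c₀ i * (c₁ j * c₂ l - c₁ l * c₂ j) - c₁ i * (c₀ j * c₂ l - c₀ l * c₂ j) + c₂ i * (c₀ j * c₁ l - c₀ l * c₁ j) ≠ 0)
    (F : Fin 3 → MvPolynomial (Fin n) K) (hF0 : F 0 = ∑ i : Fin n, monomial (Finsupp.single i (a i)) (c₀ i))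
    (hF1 : F 1 = ∑ i : Fin n, monomial (Finsupp.single i (a i)) (c₁ i)) (hF2 : F 2 = ∑ i : Fin n, monomial (Finsupp.single i (a i)) (c₂ i)) :
    ∀ w : Fin n → ℝ, (∀ i, 0 < w i) → IsCINondegenerateAlong w (fun l => (F l : MvPowerSeries (Fin n) K)) := by
  classical
  intro w _ q hq hzero
  -- the COMMON face `Φ` (equal supports)
  obtain ⟨Φ, hΦ⟩ : ∃ Φ : Finset (Fin n →₀ ℕ), Φ = (∑ i : Fin n, monomial (Finsupp.single i (a i)) (c₀ i)).support.filter
      (fun α => ∀ β ∈ (∑ i : Fin n, monomial (Finsupp.single i (a i)) (c₀ i)).support, wdeg w α ≤ wdeg w β) := ⟨_, rfl⟩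
  have hsupp : ∀ l, (F l).support = (∑ i : Fin n, monomial (Finsupp.single i (a i)) (c₀ i)).support := by
    intro l
    fin_cases l
    · simp only [Fin.zero_eta]; rw [hF0]
    · simp only [Fin.mk_one]; rw [hF1, support_diag_eq a ha c₀ c₁ hc₀ hc₁]
    · simp only [Fin.reduceFinMk]; rw [hF2, support_diag_eq a ha c₀ c₂ hc₀ hc₂]
  have hin : ∀ l, initialForm w (F l : MvPowerSeries (Fin n) K) =
      ((∑ α ∈ Φ, monomial α (coeff α (F l)) : MvPolynomial (Fin n) K) : MvPowerSeries (Fin n) K) := by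
    intro l
    rw [NewtonChartLemma.initialForm_coe_real (F l) w, hsupp l, hΦ]
  have hz : ∀ l, MvPolynomial.eval q (∑ α ∈ Φ, monomial α (coeff α (F l))) = 0 := fun l => by
    have h := hzero l
    rwa [hin l, NewtonChartLemma.evalAt_coe] at h
  have hΦsub : ∀ β ∈ Φ, ∃ i, β = Finsupp.single i (a i) := fun β hβ => by
    rw [hΦ, Finset.mem_filter] at hβ
    exact exists_eq_single_of_mem_support a c₀ β hβ.1
  have hcF : ∀ l : Fin 3, F l = ∑ i : Fin n, monomial (Finsupp.single i (a i)) ((![c₀, c₁, c₂] : Fin 3 → Fin n → K) l i) := by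
    intro l; fin_cases l <;> simp [hF0, hF1, hF2]
  -- the linear relation, coordinatewise
  rw [Fintype.linearIndependent_iff]
  intro g hg
  have hcoord : ∀ m : Fin n, Finsupp.single m (a m) ∈ Φ → g 0 * c₀ m + g 1 * c₁ m + g 2 * c₂ m = 0 := by
    intro m hm
    have h := congr_fun hg m
    simp only [Finset.sum_apply, Pi.smul_apply, smul_eq_mul, Fin.sum_univ_three, Pi.zero_apply] at h
    rw [hin 0, hin 1, hin 2, NewtonChartLemma.pderiv_coe, NewtonChartLemma.pderiv_coe, NewtonChartLemma.pderiv_coe, NewtonChartLemma.evalAt_coe,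
      NewtonChartLemma.evalAt_coe, NewtonChartLemma.evalAt_coe, hF0, hF1, hF2, eval_pderiv_faceSum a c₀ Φ hΦsub m hm ha q,
      eval_pderiv_faceSum a c₁ Φ hΦsub m hm ha q, eval_pderiv_faceSum a c₂ Φ hΦsub m hm ha q] at h
    have hM : (a m : K) * q m ^ (a m - 1) ≠ 0 := mul_ne_zero (haK m) (pow_ne_zero _ (hq m))
    have h' : (g 0 * c₀ m + g 1 * c₁ m + g 2 * c₂ m) * ((a m : K) * q m ^ (a m - 1)) = 0 := by rw [← h]; ring
    exact (mul_eq_zero.mp h').resolve_right hM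
  -- a first vertex on the face
  obtain ⟨α₁, hα₁, hmin⟩ := Finset.exists_min_image (∑ i : Fin n, monomial (Finsupp.single i (a i)) (c₀ i)).support (fun α => wdeg w α)
    (MvPolynomial.support_nonempty.mpr (diag_ne_zero hn a ha c₀ hc₀))
  have hα₁Φ : α₁ ∈ Φ := by rw [hΦ, Finset.mem_filter]; exact ⟨hα₁, hmin⟩
  obtain ⟨i, rfl⟩ := hΦsub α₁ hα₁Φ
  -- a lone vertex has no torus zero
  have htwo : ∃ β ∈ Φ, β ≠ Finsupp.single i (a i) := by
    by_contra h
    push Not at h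
    have hΦeq : Φ = {Finsupp.single i (a i)} := Finset.eq_singleton_iff_unique_mem.mpr ⟨hα₁Φ, h⟩
    have h0 := hz 0
    rw [hΦeq, Finset.sum_singleton, hF0, coeff_diag_single a ha c₀ i] at h0
    exact CensusBedsWeaklyNondegenerate.eval_monomial_ne_zero q hq _ _ (hc₀ i) h0
  obtain ⟨β, hβΦ, hβα⟩ := htwo
  obtain ⟨j, rfl⟩ := hΦsub β hβΦ
  have hij : i ≠ j := fun h => hβα (h ▸ rfl)
  -- two vertices only: the `2 × 2` minor forbids a torus zero
  by_cases hthree : ∃ γ ∈ Φ, γ ≠ Finsupp.single i (a i) ∧ γ ≠ Finsupp.single j (a j)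
  · -- three vertices: the `3 × 3` system
    obtain ⟨γ, hγΦ, hγi, hγj⟩ := hthree
    obtain ⟨l, rfl⟩ := hΦsub γ hγΦ
    have hil : i ≠ l := fun h => hγi (h ▸ rfl)
    have hjl : j ≠ l := fun h => hγj (h ▸ rfl)
    have hMg : (Matrix.of ![![c₀ i, c₁ i, c₂ i], ![c₀ j, c₁ j, c₂ j], ![c₀ l, c₁ l, c₂ l]] : Matrix (Fin 3) (Fin 3) K).mulVec g = 0 := by
      funext m
      fin_cases m
      · simpa [Matrix.mulVec, dotProduct, Fin.sum_univ_three, mul_comm] using hcoord i hα₁Φ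
      · simpa [Matrix.mulVec, dotProduct, Fin.sum_univ_three, mul_comm] using hcoord j hβΦ
      · simpa [Matrix.mulVec, dotProduct, Fin.sum_univ_three, mul_comm] using hcoord l hγΦ
    have hdet : (Matrix.of ![![c₀ i, c₁ i, c₂ i], ![c₀ j, c₁ j, c₂ j], ![c₀ l, c₁ l, c₂ l]] : Matrix (Fin 3) (Fin 3) K).det ≠ 0 := by
      rw [det_three_rows]; exact hminor3 i j l hij hjl hil
    have hg0 := Matrix.eq_zero_of_mulVec_eq_zero hdet hMg
    intro l'
    exact congr_fun hg0 l'
  · -- exactly two vertices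
    push Not at hthree
    have hΦeq : Φ = {Finsupp.single i (a i), Finsupp.single j (a j)} := by
      ext γ
      simp only [Finset.mem_insert, Finset.mem_singleton]
      constructor
      · intro hγ
        by_cases h1 : γ = Finsupp.single i (a i)
        · exact Or.inl h1
        · exact Or.inr (hthree γ hγ h1)
      · rintro (rfl | rfl)
        · exact hα₁Φ
        · exact hβΦ
    have hne : Finsupp.single i (a i) ≠ Finsupp.single j (a j) := fun h => hβα h.symm
    have h0 := hz 0
    have h1 := hz 1
    rw [hF0, eval_faceSum_pair a ha c₀ Φ i j hne hΦeq q] at h0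
    rw [hF1, eval_faceSum_pair a ha c₁ Φ i j hne hΦeq q] at h1
    have hx : (c₀ i * c₁ j - c₀ j * c₁ i) * q i ^ a i = 0 := by linear_combination c₁ j * h0 - c₀ j * h1
    exfalso
    rcases mul_eq_zero.mp hx with h | h
    · exact hminor2 i j hij (sub_eq_zero.mp h)
    · exact pow_ne_zero _ (hq i) h

/-! ## §3 No variable vanishes on `V(F₀, F₁, F₂)` -/

/-- ★ **`x̄ᵥ ≠ 0` in `k[x]/(F₀, F₁, F₂)`** for a diagonal triple with all exponents `aᵢ ≥ 2`. [folklore] -/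
theorem mk_X_ne_zero_triple (a : Fin n → ℕ) (ha2 : ∀ i, 2 ≤ a i) (c₀ c₁ c₂ : Fin n → K) (F : Fin 3 → MvPolynomial (Fin n) K)
    (hF0 : F 0 = ∑ i : Fin n, monomial (Finsupp.single i (a i)) (c₀ i)) (hF1 : F 1 = ∑ i : Fin n, monomial (Finsupp.single i (a i)) (c₁ i))
    (hF2 : F 2 = ∑ i : Fin n, monomial (Finsupp.single i (a i)) (c₂ i)) (v : Fin n) : Ideal.Quotient.mk (Ideal.span (Set.range F)) (X v) ≠ 0 := by
  classical
  intro h0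
  rw [Ideal.Quotient.eq_zero_iff_mem, Ideal.mem_span_range_iff_exists_fun] at h0
  obtain ⟨g, hg⟩ := h0
  have h := congrArg (coeff (Finsupp.single v 1)) hg
  rw [coeff_sum, Fin.sum_univ_three, hF0, hF1, hF2, coeff_single_one_mul_diag a ha2 c₀ (g 0) v, coeff_single_one_mul_diag a ha2 c₁ (g 1) v,
    coeff_single_one_mul_diag a ha2 c₂ (g 2) v, add_zero, add_zero, coeff_X] at h
  simp at h

/-! ## §4 ★ Regularity off the vertex -/

/-- If all variables but `xᵢ` lie in a prime `Q ⊇ (F₀, F₁, F₂)`, then so does `xᵢ` (`c₀ᵢxᵢ^{aᵢ} = −Σ_{j≠i} c₀ⱼxⱼ^{aⱼ}`). [folklore] -/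
theorem mk_X_mem_of_forall_ne₃ (a : Fin n → ℕ) (ha : ∀ i, a i ≠ 0) (c : Fin n → K) (hc : ∀ i, c i ≠ 0) (F : Fin 3 → MvPolynomial (Fin n) K)
    (hF0 : F 0 = ∑ i : Fin n, monomial (Finsupp.single i (a i)) (c i))
    (Q : Ideal (MvPolynomial (Fin n) K ⧸ Ideal.span (Set.range F))) [Q.IsPrime] (i : Fin n)
    (h : ∀ j, j ≠ i → Ideal.Quotient.mk (Ideal.span (Set.range F)) (X j) ∈ Q) : Ideal.Quotient.mk (Ideal.span (Set.range F)) (X i) ∈ Q := by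
  classical
  have hD : Ideal.Quotient.mk (Ideal.span (Set.range F)) (F 0) = 0 := Ideal.Quotient.eq_zero_iff_mem.mpr (Ideal.subset_span ⟨0, rfl⟩)
  rw [hF0, map_sum, ← Finset.add_sum_erase _ _ (Finset.mem_univ i)] at hD
  have hrest : ∑ j ∈ Finset.univ.erase i, Ideal.Quotient.mk (Ideal.span (Set.range F)) (monomial (Finsupp.single j (a j)) (c j)) ∈ Q := by
    refine Ideal.sum_mem _ fun j hj => ?_
    have hji : j ≠ i := (Finset.mem_erase.mp hj).1
    rw [← C_mul_X_pow_eq_monomial, map_mul, map_pow]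
    exact Q.mul_mem_left _ (Q.pow_mem_of_mem (h j hji) _ (Nat.pos_of_ne_zero (ha j)))
  have hi : Ideal.Quotient.mk (Ideal.span (Set.range F)) (monomial (Finsupp.single i (a i)) (c i)) ∈ Q := by
    rw [(eq_neg_of_add_eq_zero_left hD)]
    exact Q.neg_mem hrest
  rw [← C_mul_X_pow_eq_monomial, map_mul, map_pow,
    Ideal.unit_mul_mem_iff_mem Q (((isUnit_iff_ne_zero.mpr (hc i)).map C).map (Ideal.Quotient.mk (Ideal.span (Set.range F))))] at hi
  exact ‹Q.IsPrime›.mem_of_pow_mem _ hi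

/-- If all variables but `xᵢ, xⱼ` lie in a prime `Q ⊇ (F₀, F₁, F₂)`, then so does `xᵢ` — by the `2 × 2` minor of `(c₀, c₁)` on `(i, j)`. [folklore] -/
theorem mk_X_mem_of_two_off (a : Fin n → ℕ) (ha : ∀ i, a i ≠ 0) (c₀ c₁ : Fin n → K) (F : Fin 3 → MvPolynomial (Fin n) K)
    (hF0 : F 0 = ∑ i : Fin n, monomial (Finsupp.single i (a i)) (c₀ i)) (hF1 : F 1 = ∑ i : Fin n, monomial (Finsupp.single i (a i)) (c₁ i))
    (Q : Ideal (MvPolynomial (Fin n) K ⧸ Ideal.span (Set.range F))) [Q.IsPrime] (i j : Fin n) (hij : i ≠ j) (hminor : c₀ i * c₁ j ≠ c₀ j * c₁ i)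
    (h : ∀ m, m ≠ i → m ≠ j → Ideal.Quotient.mk (Ideal.span (Set.range F)) (X m) ∈ Q) : Ideal.Quotient.mk (Ideal.span (Set.range F)) (X i) ∈ Q := by
  classical
  set π := Ideal.Quotient.mk (Ideal.span (Set.range F)) with hπ
  -- the two-term remainders `u_c = c i x̄ᵢ^{aᵢ} + c j x̄ⱼ^{aⱼ} ∈ Q`
  have hrem : ∀ (c : Fin n → K) (l : Fin 3), F l = ∑ m : Fin n, monomial (Finsupp.single m (a m)) (c m) →
      π (C (c i)) * π (X i) ^ a i + π (C (c j)) * π (X j) ^ a j ∈ Q := by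
    intro c l hFl
    have hD : π (F l) = 0 := Ideal.Quotient.eq_zero_iff_mem.mpr (Ideal.subset_span ⟨l, rfl⟩)
    rw [hFl, map_sum, ← Finset.add_sum_erase _ _ (Finset.mem_univ i), ← Finset.add_sum_erase _ _ (Finset.mem_erase.mpr ⟨hij.symm, Finset.mem_univ j⟩)] at hD
    have hrest : ∑ m ∈ (Finset.univ.erase i).erase j, π (monomial (Finsupp.single m (a m)) (c m)) ∈ Q := by
      refine Ideal.sum_mem _ fun m hm => ?_
      have hmj : m ≠ j := (Finset.mem_erase.mp hm).1
      have hmi : m ≠ i := (Finset.mem_erase.mp (Finset.mem_erase.mp hm).2).1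
      rw [← C_mul_X_pow_eq_monomial, map_mul, map_pow]
      exact Q.mul_mem_left _ (Q.pow_mem_of_mem (h m hmi hmj) _ (Nat.pos_of_ne_zero (ha m)))
    have e : π (C (c i)) * π (X i) ^ a i + π (C (c j)) * π (X j) ^ a j =
        -(∑ m ∈ (Finset.univ.erase i).erase j, π (monomial (Finsupp.single m (a m)) (c m))) := by
      rw [eq_neg_iff_add_eq_zero, ← hD, ← C_mul_X_pow_eq_monomial, ← C_mul_X_pow_eq_monomial, map_mul, map_pow, map_mul, map_pow]
      ring
    rw [e]
    exact Q.neg_mem hrest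
  have hu := hrem c₀ 0 hF0
  have hv := hrem c₁ 1 hF1
  -- `c₁ⱼ·u − c₀ⱼ·v = (c₀ᵢc₁ⱼ − c₀ⱼc₁ᵢ)·x̄ᵢ^{aᵢ} ∈ Q`
  have hw : π (C (c₀ i * c₁ j - c₀ j * c₁ i)) * π (X i) ^ a i ∈ Q := by
    have e : π (C (c₀ i * c₁ j - c₀ j * c₁ i)) * π (X i) ^ a i =
        π (C (c₁ j)) * (π (C (c₀ i)) * π (X i) ^ a i + π (C (c₀ j)) * π (X j) ^ a j) -
          π (C (c₀ j)) * (π (C (c₁ i)) * π (X i) ^ a i + π (C (c₁ j)) * π (X j) ^ a j) := by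
      simp only [map_sub, map_mul]
      ring
    rw [e]
    exact sub_mem (Q.mul_mem_left _ hu) (Q.mul_mem_left _ hv)
  rw [Ideal.unit_mul_mem_iff_mem Q (((isUnit_iff_ne_zero.mpr (sub_ne_zero.mpr hminor)).map C).map π)] at hw
  exact ‹Q.IsPrime›.mem_of_pow_mem _ hw

/-- The `3 × 3` Jacobian minor of a diagonal triple on the columns `(i, j, l)`. [folklore] -/
theorem det_triple (a : Fin n → ℕ) (c₀ c₁ c₂ : Fin n → K) (F : Fin 3 → MvPolynomial (Fin n) K)
    (hF0 : F 0 = ∑ i : Fin n, monomial (Finsupp.single i (a i)) (c₀ i)) (hF1 : F 1 = ∑ i : Fin n, monomial (Finsupp.single i (a i)) (c₁ i))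
    (hF2 : F 2 = ∑ i : Fin n, monomial (Finsupp.single i (a i)) (c₂ i)) (i j l : Fin n) :
    (Matrix.of fun μ ν => (![(pderiv i).restrictScalars ℤ, (pderiv j).restrictScalars ℤ, (pderiv l).restrictScalars ℤ] :
        Fin 3 → Derivation ℤ (MvPolynomial (Fin n) K) (MvPolynomial (Fin n) K)) μ (F ν)).det =
      C (((a i : ℕ) : K) * (a j : ℕ) * (a l : ℕ) * (c₀ i * (c₁ j * c₂ l - c₁ l * c₂ j) - c₁ i * (c₀ j * c₂ l - c₀ l * c₂ j) + c₂ i * (c₀ j * c₁ l - c₀ l * c₁ j))) *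
        (X i ^ (a i - 1) * X j ^ (a j - 1) * X l ^ (a l - 1)) := by
  rw [Matrix.det_fin_three]
  simp only [Matrix.of_apply, Matrix.cons_val_zero, Matrix.cons_val_one, Matrix.cons_val, Derivation.restrictScalars_apply, hF0, hF1, hF2, pderiv_diag]
  simp only [← C_mul_X_pow_eq_monomial, map_mul, map_sub, map_add]
  ring

/-- ★ **`(k[x]/(F₀, F₁, F₂))_Q` IS REGULAR AT EVERY PRIME `Q ⊉ (x̄)`** for a diagonal triple generating a PRIME ideal, with `aᵢ`, the `2 × 2` minors of `(c₀, c₁)` and the `3 × 3` minors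
non-zero in `k`, all `c₀ᵢ ≠ 0`: three variables `xᵢ, xⱼ, x_l ∉ Q` survive and the Jacobian minor on them is off `Q`. [OURS · elementary certificate; cite: Matsumura1987, Thm. 30.4 (ii)] -/
theorem isRegularLocalRing_off_vertex_triple (p : ℕ) [Fact p.Prime] {k : Type} [Field k] [CharP k p] (a : Fin n → ℕ) (ha : ∀ i, a i ≠ 0)
    (hak : ∀ i, ((a i : ℕ) : k) ≠ 0) (c₀ c₁ c₂ : Fin n → k) (hc₀ : ∀ i, c₀ i ≠ 0) (hminor2 : ∀ i j, i ≠ j → c₀ i * c₁ j ≠ c₀ j * c₁ i)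
    (hminor3 : ∀ i j l, i ≠ j → j ≠ l → i ≠ l →
      c₀ i * (c₁ j * c₂ l - c₁ l * c₂ j) - c₁ i * (c₀ j * c₂ l - c₀ l * c₂ j) + c₂ i * (c₀ j * c₁ l - c₀ l * c₁ j) ≠ 0)
    (F : Fin 3 → MvPolynomial (Fin n) k)
    (hF0 : F 0 = ∑ i : Fin n, monomial (Finsupp.single i (a i)) (c₀ i)) (hF1 : F 1 = ∑ i : Fin n, monomial (Finsupp.single i (a i)) (c₁ i))
    (hF2 : F 2 = ∑ i : Fin n, monomial (Finsupp.single i (a i)) (c₂ i))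
    (Q : Ideal (MvPolynomial (Fin n) k ⧸ Ideal.span (Set.range F))) [Q.IsPrime]
    (hQ : ¬ Ideal.span (Set.range fun j : Fin n => Ideal.Quotient.mk (Ideal.span (Set.range F)) (X j)) ≤ Q) :
    IsRegularLocalRing (Localization.AtPrime Q) := by
  classical
  -- three variables off `Q`
  have hex : ∃ i, Ideal.Quotient.mk (Ideal.span (Set.range F)) (X i) ∉ Q := by
    by_contra h
    push Not at h
    exact hQ (Ideal.span_le.mpr (by rintro _ ⟨j, rfl⟩; exact h j))
  obtain ⟨i, hi⟩ := hex
  have hex2 : ∃ j, j ≠ i ∧ Ideal.Quotient.mk (Ideal.span (Set.range F)) (X j) ∉ Q := by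
    by_contra h
    push Not at h
    exact hi (mk_X_mem_of_forall_ne₃ a ha c₀ hc₀ F hF0 Q i h)
  obtain ⟨j, hji, hj⟩ := hex2
  have hex3 : ∃ l, l ≠ i ∧ l ≠ j ∧ Ideal.Quotient.mk (Ideal.span (Set.range F)) (X l) ∉ Q := by
    by_contra h
    push Not at h
    exact hi (mk_X_mem_of_two_off a ha c₀ c₁ F hF0 hF1 Q i j (Ne.symm hji) (hminor2 i j (Ne.symm hji)) h)
  obtain ⟨l, hli, hlj, hl⟩ := hex3
  -- the Jacobian minor on the columns `(i, j, l)` is off `Q`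
  have hκ : ((a i : ℕ) : k) * (a j : ℕ) * (a l : ℕ) *
      (c₀ i * (c₁ j * c₂ l - c₁ l * c₂ j) - c₁ i * (c₀ j * c₂ l - c₀ l * c₂ j) + c₂ i * (c₀ j * c₁ l - c₀ l * c₁ j)) ≠ 0 :=
    mul_ne_zero (mul_ne_zero (mul_ne_zero (hak i) (hak j)) (hak l)) (hminor3 i j l (Ne.symm hji) (Ne.symm hlj) (Ne.symm hli))
  have hndet : (Matrix.of fun μ ν => (![(pderiv i).restrictScalars ℤ, (pderiv j).restrictScalars ℤ, (pderiv l).restrictScalars ℤ] :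
      Fin 3 → Derivation ℤ (MvPolynomial (Fin n) k) (MvPolynomial (Fin n) k)) μ (F ν)).det ∉
        Q.comap (Ideal.Quotient.mk (Ideal.span (Set.range F))) := by
    rw [Ideal.mem_comap, det_triple a c₀ c₁ c₂ F hF0 hF1 hF2 i j l, map_mul,
      Ideal.unit_mul_mem_iff_mem Q (((isUnit_iff_ne_zero.mpr hκ).map C).map (Ideal.Quotient.mk (Ideal.span (Set.range F)))), map_mul, map_mul, map_pow, map_pow,
      map_pow]
    intro hmem
    rcases ‹Q.IsPrime›.mem_or_mem hmem with h12 | h3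
    · rcases ‹Q.IsPrime›.mem_or_mem h12 with h1 | h2
      · exact hi (‹Q.IsPrime›.mem_of_pow_mem _ h1)
      · exact hj (‹Q.IsPrime›.mem_of_pow_mem _ h2)
    · exact hl (‹Q.IsPrime›.mem_of_pow_mem _ h3)
  exact (CIJacobian.ci_clause_of_det_not_mem p k n 3 F Q _ hndet).1

end Summit.ResolutionOfSingularities.ResolutionOfSingularities.Theorems.FInjectiveMacaulayfication.DiagonalCITriple

end
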